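import Literature.NumberTheory.DiophantineGeometry.CatalanPUnitsFree
import Literature.FieldTheory.Kummer.KummerFiniteRank
import HarnessLib

/-!
# `q`-th roots of `p`-units of `ℚ(ζ_p)` are `p`-units; independence modulo `q`-th powers
# ([Schoof2009, Ch. 13, p. 89; Exercise 16.3])

Glue between [Schoof2009, Proposition 13.7] (`Catalan.PUnits.exists_free_generator`: the classes of
the `σ_{γ^k}(u)`, `0 ≤ k < g`, form an `𝔽_q`-basis of `E_p/E_p^q`, independence being stated with
`q`-th powers of `p`-units) and Kummer theory over `K = ℚ(ζ_p)` (independence modulo `K^{×q}`,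
`Literature.FieldTheory.Kummer.IndepModPowers`), i.e. the injectivity of `E_p/E_p^q → K^×/K^{×q}`:

* `Catalan.PUnits.exists_punit_of_pow_eq_punit` — if `z ∈ K` and `z^q = ε π^m` is a `p`-unit then
  `z = ε' π^{m'}` is a `p`-unit and `q m' = m` (`π = ζ_p - 1` is a prime element of `𝓞 K`);
* `Catalan.PUnits.indepModPowers_of_free` — the independence clause of Proposition 13.7 gives
  `IndepModPowers q (σ_{γ^i}(u))_{i < g}`.

Everything is proved; no definitions.

## References

* R. Schoof, *Catalan's Conjecture*, Universitext, Springer 2009 [Schoof2009], Ch. 13 (p. 89, the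
  group `E_p` of `p`-units), Proposition 13.7, Exercise 16.3.
-/

namespace Literature.NumberTheory.DiophantineGeometry

namespace Catalan.PUnits

open NumberField Finset
open Literature.NumberTheory.NumberFields.Stickelberger Literature.FieldTheory.Kummer
open Literature.NumberTheory.NumberFields.UnitGalois Catalan.Minus

variable {p : ℕ} [hp : Fact p.Prime] {K : Type*} [Field K] [NumberField K]
  [hK : IsCyclotomicExtension {p} ℚ K] {ζ : K} (hζ : IsPrimitiveRoot ζ p)

include hK in
/-- **A `q`-th root in `K` of a `p`-unit is a `p`-unit** (`π = ζ_p - 1` is prime in `𝓞 K`): if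
`z^q = ε π^n` with `n ≥ 0` then `z = ε' π^{m'}` with `q m' = n`. [cite: Schoof2009, Ch. 13 (p. 89)] -/
theorem exists_punit_of_pow_eq_punit_nat {q : ℕ} (hq : 0 < q) {z : K} {ε : (𝓞 K)ˣ} {n : ℕ}
    (h : z ^ q = punit hζ ε n) : ∃ (ε' : (𝓞 K)ˣ) (m' : ℕ), z = punit hζ ε' m' ∧ q * m' = n := by
  have hπp := prime_zeta_sub_one hζ
  set πO : 𝓞 K := hζ.toInteger - 1 with hπO
  -- `z` is integral
  have hzq : z ^ q = (((ε : 𝓞 K) * πO ^ n : 𝓞 K) : K) := by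
    rw [h, hπO]; unfold punit; push_cast; rw [zpow_natCast]
  have hint : IsIntegral ℤ z := by
    refine IsIntegral.of_pow hq ?_
    rw [hzq]
    exact RingOfIntegers.isIntegral_coe _
  set zO : 𝓞 K := ⟨z, hint⟩ with hzO
  have hzOq : zO ^ q = (ε : 𝓞 K) * πO ^ n := by
    apply RingOfIntegers.ext
    push_cast
    exact hzq
  have hz0 : zO ≠ 0 := by
    intro h0
    rw [h0, zero_pow hq.ne'] at hzOq
    exact (mul_ne_zero ε.ne_zero (pow_ne_zero _ hπp.ne_zero)) hzOq.symm
  -- factor out the maximal power of the prime `π`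
  obtain ⟨m', w, hw, hzw⟩ := WfDvdMonoid.max_power_factor hz0 hπp.irreducible
  have E : πO ^ (q * m') * w ^ q = (ε : 𝓞 K) * πO ^ n := by
    rw [← hzOq, hzw, mul_pow, ← pow_mul, mul_comm m']
  -- compare exponents of `π`
  have hA : ∀ k, πO ^ k ∣ (ε : 𝓞 K) * πO ^ n → k ≤ n := by
    intro k hk
    refine le_of_not_gt fun hlt => ?_
    have h1 : πO ^ (n + 1) ∣ (ε : 𝓞 K) * πO ^ n := (pow_dvd_pow πO hlt).trans hk
    obtain ⟨d, hd⟩ := h1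
    have h2 : (ε : 𝓞 K) = πO * d := by
      have : (ε : 𝓞 K) * πO ^ n = (πO * d) * πO ^ n := by rw [hd]; ring
      exact mul_right_cancel₀ (pow_ne_zero _ hπp.ne_zero) this
    exact hπp.not_unit (isUnit_of_dvd_unit ⟨d, h2⟩ ε.isUnit)
  have hB : ∀ k, πO ^ k ∣ πO ^ (q * m') * w ^ q → k ≤ q * m' := by
    intro k hk
    refine le_of_not_gt fun hlt => ?_
    have h1 : πO ^ (q * m' + 1) ∣ πO ^ (q * m') * w ^ q := (pow_dvd_pow πO hlt).trans hk
    obtain ⟨d, hd⟩ := h1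
    have h2 : w ^ q = πO * d := by
      have : πO ^ (q * m') * w ^ q = πO ^ (q * m') * (πO * d) := by rw [hd]; ring
      exact mul_left_cancel₀ (pow_ne_zero _ hπp.ne_zero) this
    exact hw (hπp.dvd_of_dvd_pow ⟨d, h2⟩)
  have hle1 : q * m' ≤ n := hA _ (E ▸ dvd_mul_right _ _)
  have hle2 : n ≤ q * m' := hB _ (E.symm ▸ dvd_mul_left _ _)
  have hmn : q * m' = n := le_antisymm hle1 hle2
  -- so `w^q = ε` and `w` is a unit
  rw [hmn] at E
  have hwq : w ^ q = (ε : 𝓞 K) := by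
    have : πO ^ n * w ^ q = πO ^ n * (ε : 𝓞 K) := by rw [E, mul_comm]
    exact mul_left_cancel₀ (pow_ne_zero _ hπp.ne_zero) this
  have hwu : IsUnit w := (isUnit_pow_iff hq.ne').mp (hwq ▸ ε.isUnit)
  refine ⟨hwu.unit, m', ?_, hmn⟩
  unfold punit
  rw [zpow_natCast, IsUnit.unit_spec]
  have : z = ((zO : 𝓞 K) : K) := rfl
  rw [this, hzw, hπO]
  push_cast
  ring

include hK in
/-- **A `q`-th root in `K` of a `p`-unit is a `p`-unit**: if `z^q = ε π^m` (`m ∈ ℤ`) then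
`z = ε' π^{m'}` with `q m' = m`. [cite: Schoof2009, Ch. 13 (p. 89), Exercise 16.3] -/
theorem exists_punit_of_pow_eq_punit {q : ℕ} (hq : 0 < q) {z : K} {ε : (𝓞 K)ˣ} {m : ℤ}
    (h : z ^ q = punit hζ ε m) : ∃ (ε' : (𝓞 K)ˣ) (m' : ℤ), z = punit hζ ε' m' ∧ (q : ℤ) * m' = m := by
  have hπ0 := piK_ne_zero hζ (K := K)
  set π : K := (((hζ.toInteger - 1 : 𝓞 K)) : K) with hπ
  -- shift the exponent to make it non-negative
  set N : ℕ := m.natAbs with hN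
  have hmN : 0 ≤ m + q * N := by
    have h1 : -m ≤ (N : ℤ) := by
      have := Int.le_natAbs (a := -m)
      rwa [Int.natAbs_neg] at this
    have hq1 : (1 : ℤ) ≤ q := by exact_mod_cast hq
    have hN0 : (0 : ℤ) ≤ N := Nat.cast_nonneg N
    nlinarith
  set n : ℕ := (m + q * N).toNat with hndef
  have hn : (n : ℤ) = m + q * N := Int.toNat_of_nonneg hmN
  have h1 : (z * π ^ N) ^ q = punit hζ ε n := by
    rw [mul_pow, h, ← pow_mul]
    unfold punit
    rw [← hπ, hn, zpow_add₀ hπ0, ← Nat.cast_mul, zpow_natCast, mul_comm N q, mul_assoc]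
  obtain ⟨ε', m₁, hz₁, hqm₁⟩ := exists_punit_of_pow_eq_punit_nat hζ hq h1
  refine ⟨ε', (m₁ : ℤ) - N, ?_, ?_⟩
  · have hπN : π ^ N ≠ 0 := pow_ne_zero _ hπ0
    have hz : z = punit hζ ε' m₁ * (π ^ N)⁻¹ := by
      rw [← hz₁, mul_inv_cancel_right₀ hπN]
    rw [hz]
    unfold punit
    rw [← hπ, zpow_sub₀ hπ0, zpow_natCast, zpow_natCast, div_eq_mul_inv, mul_assoc]
  · have : (q : ℤ) * (m₁ : ℤ) = n := by exact_mod_cast hqm₁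
    rw [mul_sub, this, hn]
    ring

include hK in
/-- the `σ_a`-conjugates of a `p`-unit are non-zero. [folklore] -/
theorem gal_punit_ne_zero (a : (ZMod p)ˣ) (ε : (𝓞 K)ˣ) (m : ℤ) : gal p K a (punit hζ ε m) ≠ 0 := by
  rw [map_ne_zero]
  unfold punit
  exact mul_ne_zero (coe_unit_ne_zero ε) (zpow_ne_zero _ (piK_ne_zero hζ))

include hK in
/-- **Independence modulo `q`-th powers of `p`-units gives independence modulo `K^{×q}`**
([Schoof2009, Exercise 16.3]: `E_p ∩ K^{×q} = E_p^q`).  With `u = ε₀ π^{k₀}` and a generator `γ`: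
if `∏_k σ_{γ^k}(u)^{c_k} ∈ E_p^q` forces `q ∣ c_k` (the independence clause of
[Schoof2009, Prop. 13.7], `Catalan.PUnits.exists_free_generator`), then the family
`(σ_{γ^i}(u))_{i<g}` satisfies `IndepModPowers q`. [cite: Schoof2009, Proposition 13.7 and Exercise 16.3] -/
theorem indepModPowers_of_free {q : ℕ} (hq : 0 < q) {g : ℕ} [NeZero g] {γ : (ZMod p)ˣ}
    {ε₀ : (𝓞 K)ˣ} {k₀ : ℤ}
    (hii : ∀ (c : ZMod g → ℕ) (ε' : (𝓞 K)ˣ) (m' : ℤ),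
      (∏ k : ZMod g, (gal p K (γ ^ k.val) (punit hζ ε₀ k₀)) ^ (c k)) = (punit hζ ε' m') ^ q →
        ∀ k, q ∣ c k) :
    IndepModPowers q (fun i : Fin g => gal p K (γ ^ (i : ℕ)) (punit hζ ε₀ k₀)) := by
  classical
  intro v hx i
  obtain ⟨x, hx⟩ := hx
  set u : Fin g → K := fun i => gal p K (γ ^ (i : ℕ)) (punit hζ ε₀ k₀) with hudef
  have hu0 : ∀ i, u i ≠ 0 := fun i => gal_punit_ne_zero hζ _ _ _
  -- `v i = c i + q d i` with `0 ≤ c i < q`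
  set c : Fin g → ℕ := fun i => (v i % q).toNat with hcdef
  set d : Fin g → ℤ := fun i => v i / q with hddef
  have hq0 : (q : ℤ) ≠ 0 := by exact_mod_cast hq.ne'
  have hc : ∀ i, (c i : ℤ) = v i % q := fun i =>
    Int.toNat_of_nonneg (Int.emod_nonneg _ hq0)
  have hvcd : ∀ i, v i = c i + q * d i := fun i => by
    rw [hc, hddef, Int.emod_def]
    ring
  -- `∏ u^v = (∏ u^c) (∏ u^d)^q`
  have hprod : ∏ i, u i ^ v i = (∏ i, u i ^ c i) * (∏ i, u i ^ d i) ^ q := by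
    rw [← Finset.prod_pow, ← Finset.prod_mul_distrib]
    refine Finset.prod_congr rfl fun i _ => ?_
    rw [hvcd i, zpow_add₀ (hu0 i), zpow_natCast, mul_comm (q : ℤ), zpow_mul, zpow_natCast]
  set D : K := ∏ i, u i ^ d i with hD
  have hD0 : D ≠ 0 := Finset.prod_ne_zero_iff.mpr fun i _ => zpow_ne_zero _ (hu0 i)
  set z : K := x / D with hz
  have hzq : z ^ q = ∏ i, u i ^ c i := by
    rw [hz, div_pow, hx]
    show (∏ i, u i ^ v i) / D ^ q = _
    rw [hprod, mul_div_assoc, div_self (pow_ne_zero _ hD0), mul_one]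
  -- the right hand side is a `p`-unit
  have hpu : ∃ (E : (𝓞 K)ˣ) (M : ℤ), ∏ i, u i ^ c i = punit hζ E M := by
    refine ⟨∏ i : Fin g, (unitsGal (gal p K (γ ^ (i : ℕ))) ε₀ * uσ hζ (γ ^ (i : ℕ)) ^ k₀) ^ c i,
      ∑ i : Fin g, (c i : ℤ) * k₀, ?_⟩
    rw [← punit_prod]
    refine Finset.prod_congr rfl fun i _ => ?_
    rw [hudef]
    simp only
    rw [gal_punit, punit_pow]
  obtain ⟨E, M, hEM⟩ := hpu
  have hzq' : z ^ q = punit hζ E M := by rw [hzq, hEM]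
  obtain ⟨ε', m', hz', -⟩ := exists_punit_of_pow_eq_punit hζ hq hzq'
  -- reindex by `ZMod g` and apply the independence clause
  set e : ZMod g → Fin g := fun k => ⟨k.val, ZMod.val_lt k⟩ with he
  have hebij : Function.Bijective e := by
    rw [Fintype.bijective_iff_injective_and_card]
    refine ⟨fun a b hab => ZMod.val_injective g (by simpa [he] using congrArg Fin.val hab), ?_⟩
    rw [ZMod.card, Fintype.card_fin]
  set eqv : ZMod g ≃ Fin g := Equiv.ofBijective e hebij with heqv
  have key := hii (fun k => c (eqv k)) ε' m' ?_ (eqv.symm i)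
  · rw [Equiv.apply_symm_apply] at key
    rw [hvcd i]
    obtain ⟨t, ht⟩ := key
    exact ⟨t + d i, by rw [ht]; push_cast; ring⟩
  · rw [← hz', hzq]
    exact Fintype.prod_equiv eqv _ _ fun k => rfl


end Catalan.PUnits

end Literature.NumberTheory.DiophantineGeometry
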